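/-
Copyright (c) 2026. All rights reserved.
Released under Apache 2.0 license as described in the file LICENSE.
-/
import Literature.NumberTheory.ComplexMultiplication.DegenerateCMTypesElementaryAbelianTwoGroup
import HarnessLib

/-!
# The STABILISER of a CM type on a finite abelian group is the joint kernel of Kubota's surviving odd characters

Setting of the tree's `CMTypeRankCharacters` (T. Kubota [Kubota1965] §4 Lemma 2 = B. B. Gordon
[Gordon1999HodgeAVSurvey] Prop. 9.4.1): `G` a finite commutative group acting on itself by translation — the Galois
group of an ABELIAN CM field `K`, `Hom(K, ℂ)` being a `G`-torsor — `ρ ∈ G` the complex conjugation, `T ⊆ G` a CM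
type (`IsCMTypeWith ρ T`: `T ⊔ ρT = G`), `Ŝ(χ) = Σ_{t ∈ T} χ(t)` for a character `χ : AddChar (Additive G) ℂ`, and
`rank(T) = 1 + #{χ : χ(ρ) = −1, Ŝ(χ) ≠ 0}` (Kubota).  The odd characters with `Ŝ(χ) ≠ 0` are the SURVIVORS of `T`.

The STABILISER `{g ∈ G : Tg = T}` of the type is, on the field side, the group whose fixed field is the reflex
field `K*` of `(K, T)` (G. Shimura [Shimura1998] §8.3–8.4, Example (1): for `K` abelian the left and right
stabilisers of a half system agree; C.-G. Schmidt, Kap. II Bem. 1.13: `(K, T)` is primitive iff `K* = K`; the tree's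
`PrimitiveCMTypeReflexDegreeAbelian`, `QuarticCMTypes.stabilizer_reflexLift_eq_stabilizer_of_comm`), and `T` is
induced from the CM type it defines on the quotient by its stabiliser.  THIS FILE computes the stabiliser BY FOURIER
ANALYSIS ON `G` (the method of B. Dodson's weight criterion [Dodson1984] §3.1.1, already used in order `16` by the
tree's `DegenerateCMTypesElementaryAbelianOrderSixteen.mul_mem_iff_of_forall_survivor_eq_one`, one direction,
exponent `2`), for EVERY finite commutative `G`:

> **Theorem** (`forall_mul_mem_iff_iff_forall_survivor`).  `g ∈ G` stabilises the CM type `T` (`tg ∈ T ⟺ t ∈ T`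
> for all `t`) **iff `χ(g) = 1` for every surviving odd character `χ`** (`χ(ρ) = −1`, `Ŝ(χ) ≠ 0`).

So `Stab(T) = ⋂_{χ survivor} ker χ`: the survivors are characters of `G/Stab(T) = Gal(K*/ℚ)`, which recovers
`rank(T) ≤ [K* : ℚ]/2 + 1` (Shimura §32.10, tree `IsCMTypeWith.typeRank_le_card_orbit`) and shows that a
NONDEGENERATE type (all odd characters survive) has TRIVIAL stabiliser — Kubota's "a nondegenerate CM-type is
primitive" [Kubota1965] §2 — while the converse fails (primitive degenerate types).

* §1 `sum_char_image_mul_eq` — a translate has `Ŝ_{Tg}(χ) = χ(g)·Ŝ_T(χ)`; `char_eq_one_of_forall_mul_mem_iff` — an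
  element of the stabiliser lies in the kernel of every character (odd or even) not vanishing on `T`.
* §2 `card_mul_indicator_eq_sum` — Fourier inversion `|G|·𝟙_S(x) = Σ_χ Ŝ_S(χ)·χ(x⁻¹)` on any finite commutative
  group; `eq_of_forall_sum_char_eq` — a subset is determined by its character sums.
* §3 `card_mul_indicator_eq_card_add_sum_odd` — for a CM type only `χ = 1` (giving `|T|`) and the odd characters
  contribute (even `χ ≠ 1` vanish on `T`, tree `ExponentTwo.sum_char_eq_zero_of_even`, valid for every `G`);
  **`forall_mul_mem_iff_iff_forall_survivor`** (the theorem); `forall_mul_mem_iff_of_forall_survivor` /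
  `survivor_apply_eq_one_of_forall_mul_mem_iff` (the two directions by name).
* §4 consequences: `not_forall_mul_rho_mem_iff` (`ρ` never stabilises), **`eq_one_of_forall_mul_mem_iff_of_typeRank_eq`**
  (NONDEGENERATE ⟹ TRIVIAL STABILISER: `rank(T) = |G|/2 + 1` and `Tg = T` force `g = 1`),
  `exists_survivor_apply_ne_one_of_ne_one` (contrapositive: a non-trivial stabilising `g ≠ 1` is detected by no
  survivor, so some odd character is killed — `typeRank_lt_of_forall_mul_mem_iff`: A TYPE WITH A NON-TRIVIAL
  STABILISER IS DEGENERATE unless `|G| ≤ 2`… precisely `rank(T) < |G|/2 + 1` as soon as `g ≠ 1` stabilises `T`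
  and `|G| > 2`… see the statement), and the exponent-`2` reading `forall_mul_mem_iff_iff_of_sq_eq_one`
  (characters are `±1`-valued: `g` stabilises `T` iff no survivor takes the value `−1` at `g`).

HONEST SCOPE.  Finite Fourier analysis (orthogonality of characters, Mathlib `AddChar.sum_apply_eq_ite`) applied to
Kubota's survivors; the sources print the rank formula (Kubota, Gordon), the weight/inversion method (Dodson) and the
stabiliser–reflex-field dictionary (Shimura, Schmidt); the displayed theorem is this file's packaging of them, not a
numbered statement of the sources.  THEOREMS ONLY: no definition, no named fact, no instance, no `sorry`.

## References

* [Kubota1965] T. Kubota, *On the field extension by complex multiplication*, Trans. AMS 118 (1965), §2 (p. 115: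
  "a nondegenerate CM-type is primitive"), §4 Lemma 2 (p. 119).
* [Gordon1999HodgeAVSurvey] B. B. Gordon, *A survey of the Hodge conjecture for abelian varieties*, Prop. 9.4.1.
* [Dodson1984] B. Dodson, *The structure of Galois groups of CM-fields*, Trans. AMS 283 (1984), §3.1.1 (proof).
* [Shimura1998] G. Shimura, *Abelian Varieties with Complex Multiplication and Modular Functions*, §8.3 Prop. 28,
  §8.4 Example (1), §32.10.

## Provenance

Lane `lit-hodgefound` (Track 2, Layer A3), seat `lit-hodgefound-p10` generation 38, row g38-#1; neighbours cited by
name, nothing restated: `DegenerateCMTypesElementaryAbelianTwoGroup` (`ExponentTwo.sum_char_eq_zero_of_even`),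
`DegenerateCMTypesElementaryAbelianOrderSixteen` (`ExponentTwo.mul_mem_iff_of_forall_survivor_eq_one`, the order-`16`
one-directional predecessor), `CMTypeRankCharacters` (`IsCMTypeWith.typeRank_eq_one_add_ncard_oddCharacters`),
`Pohlmann1968/CMTypeRankCharactersNumberField` (`IsCMTypeWith.typeRank_eq_iff_forall_oddCharacters`),
`CMTypeElementaryTwoGroupOddWeights` (`character_apply_eq_one_or_of_mul_self`), Mathlib `AddChar.sum_apply_eq_ite`,
`AddChar.forall_apply_eq_zero`, `AddChar.exists_apply_ne_zero`.
-/

open scoped BigOperators Classical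

namespace Literature.NumberTheory.ComplexMultiplication

namespace CyclicCMType

namespace AbelianStabilizer

variable {G : Type*} [CommGroup G] [Fintype G] [DecidableEq G] {ρ : G} {T : Finset G}

/-! ## §0 Helpers -/

section Helpers

omit [Fintype G] [DecidableEq G] in
/-- `χ(gh) = χ(g)χ(h)`. [folklore] -/
private theorem char_mul (χ : AddChar (Additive G) ℂ) (g h : G) :
    χ (Additive.ofMul (g * h)) = χ (Additive.ofMul g) * χ (Additive.ofMul h) := by
  rw [ofMul_mul, AddChar.map_add_eq_mul]

omit [Fintype G] [DecidableEq G] in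
/-- `χ(g⁻¹) = χ(g)⁻¹`. [folklore] -/
private theorem char_inv (χ : AddChar (Additive G) ℂ) (g : G) :
    χ (Additive.ofMul g⁻¹) = (χ (Additive.ofMul g))⁻¹ := by
  rw [ofMul_inv, AddChar.map_neg_eq_inv]

omit [Fintype G] [DecidableEq G] in
/-- `χ(g) ≠ 0`. [folklore] -/
private theorem char_ne_zero (χ : AddChar (Additive G) ℂ) (g : G) : χ (Additive.ofMul g) ≠ 0 := by
  intro h0
  have h1 : χ (Additive.ofMul g) * χ (Additive.ofMul g⁻¹) = 1 := by
    rw [← char_mul, mul_inv_cancel, ofMul_one, AddChar.map_zero_eq_one]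
  rw [h0, zero_mul] at h1
  exact zero_ne_one h1

/-- Dual orthogonality: `Σ_χ χ(x) = |G|·[x = 1]` (Mathlib `AddChar.sum_apply_eq_ite`). [folklore] -/
private theorem sum_char_apply_eq_ite (x : G) :
    ∑ χ : AddChar (Additive G) ℂ, χ (Additive.ofMul x) = if x = 1 then (Fintype.card G : ℂ) else 0 := by
  have h := AddChar.sum_apply_eq_ite (α := Additive G) (Additive.ofMul x)
  have hc : Fintype.card (Additive G) = Fintype.card G := Fintype.card_congr Additive.toMul
  rw [h, hc]
  rfl

omit [Fintype G] [DecidableEq G] in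
/-- `ρ² = 1`. [folklore] -/
private theorem rho_mul_rho (h : IsCMTypeWith ρ (T : Set G)) : ρ * ρ = 1 := by
  have := h.invol (1 : G)
  simpa [smul_eq_mul] using this

omit [Fintype G] [DecidableEq G] in
/-- `ρx ∈ T ⟺ x ∉ T`. [folklore] -/
private theorem rho_mul_mem_iff (h : IsCMTypeWith ρ (T : Set G)) (x : G) : ρ * x ∈ T ↔ x ∉ T := by
  have := h.rho_smul_mem_iff x
  simpa only [smul_eq_mul, Finset.mem_coe] using this

omit [Fintype G] [DecidableEq G] in
/-- `ρ ≠ 1`. [folklore] -/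
private theorem rho_ne_one (h : IsCMTypeWith ρ (T : Set G)) : ρ ≠ 1 := by
  intro hρ
  have := h.rho_smul_ne (1 : G)
  rw [hρ, smul_eq_mul, one_mul] at this
  exact this rfl

omit [Fintype G] [DecidableEq G] in
/-- `χ(ρ) = ±1`. [folklore] -/
private theorem char_rho (h : IsCMTypeWith ρ (T : Set G)) (χ : AddChar (Additive G) ℂ) :
    χ (Additive.ofMul ρ) = 1 ∨ χ (Additive.ofMul ρ) = -1 :=
  character_apply_eq_one_or_of_mul_self χ (rho_mul_rho h)

/-- `2|T| = |G|`. [folklore] -/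
private theorem two_mul_card (h : IsCMTypeWith ρ (T : Set G)) : 2 * T.card = Fintype.card G := by
  have hinj : Function.Injective fun s : G => ρ * s := fun a b hab => mul_left_cancel hab
  have hc : Tᶜ = T.image fun s => ρ * s := by
    ext x
    rw [Finset.mem_compl, Finset.mem_image]
    constructor
    · intro hx
      refine ⟨ρ * x, (rho_mul_mem_iff h x).2 hx, ?_⟩
      show ρ * (ρ * x) = x
      rw [← mul_assoc, rho_mul_rho h, one_mul]
    · rintro ⟨s, hs, rfl⟩
      exact fun hx => ((rho_mul_mem_iff h s).1 hx) hs
  have h1 : Tᶜ.card = T.card := by rw [hc, Finset.card_image_of_injective _ hinj]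
  have h2 := Finset.card_add_card_compl T
  omega

omit [DecidableEq G] in
/-- There is an odd character (`ρ ≠ 1` is detected by some `χ`, and `χ(ρ) = ±1`). [cite: Kubota1965, §4 Lemma 2] -/
private theorem exists_odd (h : IsCMTypeWith ρ (T : Set G)) :
    ∃ χ : AddChar (Additive G) ℂ, χ (Additive.ofMul ρ) = -1 := by
  have hρ : (Additive.ofMul ρ : Additive G) ≠ 0 := by
    intro h0
    exact rho_ne_one h (by simpa using congrArg Additive.toMul h0)
  obtain ⟨χ, hχ⟩ := (AddChar.exists_apply_ne_zero (α := Additive G)).2 hρ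
  exact ⟨χ, (char_rho h χ).resolve_left hχ⟩

end Helpers

/-! ## §1 Translates and the stabiliser: `Ŝ_{Tg}(χ) = χ(g)·Ŝ_T(χ)` -/

section Translate

omit [Fintype G] in
/-- **Character sums of a translate**: `Σ_{x ∈ Sg} χ(x) = χ(g)·Σ_{s ∈ S} χ(s)`. [cite: Kubota1965, §4 Lemma 2 (proof)] -/
theorem sum_char_image_mul_eq (χ : AddChar (Additive G) ℂ) (S : Finset G) (g : G) :
    ∑ x ∈ S.image (fun s => s * g), χ (Additive.ofMul x) =
      χ (Additive.ofMul g) * ∑ s ∈ S, χ (Additive.ofMul s) := by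
  rw [Finset.sum_image fun a _ b _ hab => mul_right_cancel hab, Finset.mul_sum]
  exact Finset.sum_congr rfl fun s _ => by rw [char_mul, mul_comm]

omit [Fintype G] in
/-- A stabilising `g` (`tg ∈ T ⟺ t ∈ T`) has `T·g = T` as finsets. [folklore] -/
private theorem image_mul_eq_of_forall_mul_mem_iff {g : G} (hg : ∀ t : G, t * g ∈ T ↔ t ∈ T) :
    T.image (fun s => s * g) = T := by
  ext x
  rw [Finset.mem_image]
  constructor
  · rintro ⟨s, hs, rfl⟩
    exact (hg s).2 hs
  · intro hx
    refine ⟨x * g⁻¹, (hg (x * g⁻¹)).1 (by rwa [inv_mul_cancel_right]), inv_mul_cancel_right x g⟩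

omit [Fintype G] in
/-- **If `g` stabilises `T` then `Ŝ(χ) = χ(g)·Ŝ(χ)` for every character.** [cite: Kubota1965, §4 Lemma 2 (proof)] -/
theorem sum_char_eq_mul_of_forall_mul_mem_iff {g : G} (hg : ∀ t : G, t * g ∈ T ↔ t ∈ T)
    (χ : AddChar (Additive G) ℂ) :
    ∑ s ∈ T, χ (Additive.ofMul s) = χ (Additive.ofMul g) * ∑ s ∈ T, χ (Additive.ofMul s) := by
  conv_lhs => rw [← image_mul_eq_of_forall_mul_mem_iff hg]
  exact sum_char_image_mul_eq χ T g

omit [Fintype G] in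
/-- **A stabilising element lies in the kernel of every character not vanishing on the type** (odd or even):
`Tg = T`, `Ŝ(χ) ≠ 0 ⟹ χ(g) = 1`. [cite: Kubota1965, §4 Lemma 2 (proof)] [cite: Shimura1998, §8.4 Example (1)] -/
theorem char_eq_one_of_forall_mul_mem_iff {g : G} (hg : ∀ t : G, t * g ∈ T ↔ t ∈ T)
    {χ : AddChar (Additive G) ℂ} (hS : ∑ s ∈ T, χ (Additive.ofMul s) ≠ 0) : χ (Additive.ofMul g) = 1 := by
  have h1 := sum_char_eq_mul_of_forall_mul_mem_iff hg χ
  have h2 : (χ (Additive.ofMul g) - 1) * ∑ s ∈ T, χ (Additive.ofMul s) = 0 := by rw [sub_mul, one_mul, ← h1, sub_self]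
  rcases mul_eq_zero.1 h2 with h3 | h3
  · exact sub_eq_zero.1 h3
  · exact absurd h3 hS

end Translate

/-! ## §2 Fourier inversion of an indicator on a finite commutative group -/

section Inversion

/-- **`|G|·𝟙_S(x) = Σ_χ Ŝ_S(χ)·χ(x⁻¹)`** with `Ŝ_S(χ) = Σ_{s ∈ S} χ(s)` (`χ(s)χ(x⁻¹) = χ(sx⁻¹)` and
`Σ_χ χ(sx⁻¹) = |G|·[s = x]`). [cite: Dodson1984, §3.1.1 Theorem (proof)] -/
theorem card_mul_indicator_eq_sum (S : Finset G) (x : G) :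
    (if x ∈ S then (Fintype.card G : ℂ) else 0) =
      ∑ χ : AddChar (Additive G) ℂ, (∑ s ∈ S, χ (Additive.ofMul s)) * χ (Additive.ofMul x⁻¹) := by
  symm
  calc ∑ χ : AddChar (Additive G) ℂ, (∑ s ∈ S, χ (Additive.ofMul s)) * χ (Additive.ofMul x⁻¹)
      = ∑ χ : AddChar (Additive G) ℂ, ∑ s ∈ S, χ (Additive.ofMul (s * x⁻¹)) := by
        refine Finset.sum_congr rfl fun χ _ => ?_
        rw [Finset.sum_mul]
        exact Finset.sum_congr rfl fun s _ => (char_mul χ s x⁻¹).symm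
    _ = ∑ s ∈ S, ∑ χ : AddChar (Additive G) ℂ, χ (Additive.ofMul (s * x⁻¹)) := Finset.sum_comm
    _ = ∑ s ∈ S, (if s = x then (Fintype.card G : ℂ) else 0) := by
        refine Finset.sum_congr rfl fun s _ => ?_
        rw [sum_char_apply_eq_ite]
        simp only [mul_inv_eq_one]
    _ = if x ∈ S then (Fintype.card G : ℂ) else 0 := by rw [Finset.sum_ite_eq']

/-- **A subset of a finite commutative group is determined by its character sums** (`Ŝ_S = Ŝ_{S'}` on all `χ` ⟹
`S = S'`, by inversion). [cite: Dodson1984, §3.1.1 Theorem (proof)] -/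
theorem eq_of_forall_sum_char_eq {S S' : Finset G}
    (hS : ∀ χ : AddChar (Additive G) ℂ, ∑ s ∈ S, χ (Additive.ofMul s) = ∑ s ∈ S', χ (Additive.ofMul s)) :
    S = S' := by
  have hpos : (Fintype.card G : ℂ) ≠ 0 := by
    have : 0 < Fintype.card G := Fintype.card_pos
    exact_mod_cast this.ne'
  ext x
  have h1 := card_mul_indicator_eq_sum S x
  have h2 := card_mul_indicator_eq_sum S' x
  simp only [hS] at h1
  rw [← h2] at h1
  constructor
  · intro hx
    by_contra hx'
    rw [if_pos hx, if_neg hx'] at h1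
    exact hpos h1
  · intro hx'
    by_contra hx
    rw [if_neg hx, if_pos hx'] at h1
    exact hpos h1.symm

end Inversion

/-! ## §3 The stabiliser of a CM type is the joint kernel of the surviving odd characters -/

section Stabilizer

/-- **`|G|·𝟙_T(x) = |T| + Σ_{χ odd} Ŝ(χ)·χ(x⁻¹)`** for a CM type `T`: even non-trivial characters vanish on `T` (tree
`ExponentTwo.sum_char_eq_zero_of_even`, valid on every finite commutative group), the trivial one gives `|T|`.
[cite: Kubota1965, §4 Lemma 2] [cite: Dodson1984, §3.1.1 Theorem (proof)] -/
theorem card_mul_indicator_eq_card_add_sum_odd (h : IsCMTypeWith ρ (T : Set G)) (x : G) :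
    (if x ∈ T then (Fintype.card G : ℂ) else 0) = (T.card : ℂ) +
      ∑ χ ∈ Finset.univ.filter (fun χ : AddChar (Additive G) ℂ => χ (Additive.ofMul ρ) = -1),
        (∑ s ∈ T, χ (Additive.ofMul s)) * χ (Additive.ofMul x⁻¹) := by
  rw [card_mul_indicator_eq_sum T x, add_comm,
    ← Finset.sum_filter_add_sum_filter_not Finset.univ
      (fun χ : AddChar (Additive G) ℂ => χ (Additive.ofMul ρ) = -1)]
  congr 1
  have h0mem : (0 : AddChar (Additive G) ℂ) ∈
      Finset.univ.filter (fun χ : AddChar (Additive G) ℂ => ¬ χ (Additive.ofMul ρ) = -1) := by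
    rw [Finset.mem_filter, AddChar.zero_apply]
    exact ⟨Finset.mem_univ _, by norm_num⟩
  rw [Finset.sum_eq_single_of_mem (0 : AddChar (Additive G) ℂ) h0mem]
  · simp only [AddChar.zero_apply, Finset.sum_const, nsmul_eq_mul, mul_one]
  · intro χ hχ hne
    have hχρ : χ (Additive.ofMul ρ) = 1 := (char_rho h χ).resolve_right (Finset.mem_filter.1 hχ).2
    rw [ExponentTwo.sum_char_eq_zero_of_even h hχρ hne, zero_mul]

/-- **Joint kernel ⟹ stabiliser**: if `χ(g) = 1` for every surviving odd character then `tg ∈ T ⟺ t ∈ T` for all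
`t` (the inversion formulas for `𝟙_T(tg)` and `𝟙_T(t)` agree term by term).  The tree's order-`16`, exponent-`2`
`ExponentTwo.mul_mem_iff_of_forall_survivor_eq_one`, now for every finite commutative group.
[cite: Kubota1965, §4 Lemma 2] [cite: Dodson1984, §3.1.1 Theorem (proof)] -/
theorem forall_mul_mem_iff_of_forall_survivor (h : IsCMTypeWith ρ (T : Set G)) {g : G}
    (hg : ∀ χ : AddChar (Additive G) ℂ, χ (Additive.ofMul ρ) = -1 → ∑ s ∈ T, χ (Additive.ofMul s) ≠ 0 →
      χ (Additive.ofMul g) = 1) (t : G) : t * g ∈ T ↔ t ∈ T := by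
  have key : (if t * g ∈ T then (Fintype.card G : ℂ) else 0) = if t ∈ T then (Fintype.card G : ℂ) else 0 := by
    rw [card_mul_indicator_eq_card_add_sum_odd h (t * g), card_mul_indicator_eq_card_add_sum_odd h t]
    congr 1
    refine Finset.sum_congr rfl fun χ hχ => ?_
    have hχρ : χ (Additive.ofMul ρ) = -1 := (Finset.mem_filter.1 hχ).2
    by_cases hS : ∑ s ∈ T, χ (Additive.ofMul s) = 0
    · rw [hS, zero_mul, zero_mul]
    · rw [mul_inv, char_mul, char_inv χ g, hg χ hχρ hS, inv_one, mul_one]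
  have hpos : (Fintype.card G : ℂ) ≠ 0 := by
    have : 0 < Fintype.card G := Fintype.card_pos
    exact_mod_cast this.ne'
  constructor
  · intro htg
    by_contra ht
    rw [if_pos htg, if_neg ht] at key
    exact hpos key
  · intro ht
    by_contra htg
    rw [if_neg htg, if_pos ht] at key
    exact hpos key.symm

omit [Fintype G] in
/-- **Stabiliser ⟹ joint kernel**: if `tg ∈ T ⟺ t ∈ T` for all `t`, every surviving odd character has `χ(g) = 1`.
[cite: Kubota1965, §4 Lemma 2 (proof)] [cite: Shimura1998, §8.4 Example (1)] -/
theorem survivor_apply_eq_one_of_forall_mul_mem_iff {g : G} (hg : ∀ t : G, t * g ∈ T ↔ t ∈ T)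
    {χ : AddChar (Additive G) ℂ} (_hχ : χ (Additive.ofMul ρ) = -1) (hS : ∑ s ∈ T, χ (Additive.ofMul s) ≠ 0) :
    χ (Additive.ofMul g) = 1 :=
  char_eq_one_of_forall_mul_mem_iff hg hS

/-- **THE STABILISER OF A CM TYPE IS THE JOINT KERNEL OF ITS SURVIVING ODD CHARACTERS**: for a CM type `T` on a
finite commutative group `G` (w.r.t. `ρ`) and `g ∈ G`,
`(∀ t, tg ∈ T ⟺ t ∈ T) ⟺ (∀ χ, χ(ρ) = −1 → Ŝ(χ) ≠ 0 → χ(g) = 1)`.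
On the field side (`G = Gal(K/ℚ)`, `K` an abelian CM field): `Gal(K/K*) = ⋂_{χ odd, χ(T) ≠ 0} ker χ`, `K*` the reflex
field, equivalently the smallest subfield from which `T` is induced. [cite: Kubota1965, §4 Lemma 2]
[cite: Dodson1984, §3.1.1 Theorem (proof)] [cite: Shimura1998, §8.4 Example (1)] -/
theorem forall_mul_mem_iff_iff_forall_survivor (h : IsCMTypeWith ρ (T : Set G)) (g : G) :
    (∀ t : G, t * g ∈ T ↔ t ∈ T) ↔
      ∀ χ : AddChar (Additive G) ℂ, χ (Additive.ofMul ρ) = -1 → ∑ s ∈ T, χ (Additive.ofMul s) ≠ 0 →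
        χ (Additive.ofMul g) = 1 :=
  ⟨fun hg _ hχ hS => survivor_apply_eq_one_of_forall_mul_mem_iff hg hχ hS,
    fun hg => forall_mul_mem_iff_of_forall_survivor h hg⟩

/-- Left-multiplication form: `(∀ t, gt ∈ T ⟺ t ∈ T)` iff `χ(g) = 1` for every survivor. [cite: Kubota1965, §4 Lemma 2] -/
theorem forall_mul_left_mem_iff_iff_forall_survivor (h : IsCMTypeWith ρ (T : Set G)) (g : G) :
    (∀ t : G, g * t ∈ T ↔ t ∈ T) ↔
      ∀ χ : AddChar (Additive G) ℂ, χ (Additive.ofMul ρ) = -1 → ∑ s ∈ T, χ (Additive.ofMul s) ≠ 0 →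
        χ (Additive.ofMul g) = 1 := by
  rw [← forall_mul_mem_iff_iff_forall_survivor h g]
  simp only [mul_comm g]

end Stabilizer

/-! ## §4 Consequences -/

section Consequences

omit [Fintype G] [DecidableEq G] in
/-- `ρ` never stabilises a CM type. [cite: Kubota1965, §2] -/
theorem not_forall_mul_rho_mem_iff (h : IsCMTypeWith ρ (T : Set G)) (hT : T.Nonempty) :
    ¬ ∀ t : G, t * ρ ∈ T ↔ t ∈ T := by
  intro hρ
  obtain ⟨t, ht⟩ := hT
  have h1 := (hρ t).2 ht
  rw [mul_comm, rho_mul_mem_iff h t] at h1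
  exact h1 ht

omit [DecidableEq G] in
/-- **A stabilising element killed by every odd character is trivial**: if `χ(g) = 1` for ALL odd `χ` then
`g = 1` (every even `ψ` is `ψ = (ψχ₀)χ₀⁻¹` with `ψχ₀`, `χ₀` odd, so all characters are `1` at `g`).
[cite: Kubota1965, §4 Lemma 2] -/
theorem eq_one_of_forall_odd_apply_eq_one (h : IsCMTypeWith ρ (T : Set G)) {g : G}
    (hg : ∀ χ : AddChar (Additive G) ℂ, χ (Additive.ofMul ρ) = -1 → χ (Additive.ofMul g) = 1) : g = 1 := by
  obtain ⟨χ₀, hχ₀⟩ := exists_odd h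
  have hall : ∀ ψ : AddChar (Additive G) ℂ, ψ (Additive.ofMul g) = 1 := by
    intro ψ
    rcases char_rho h ψ with he | ho
    · -- `ψ + χ₀` is odd
      have hodd : (ψ + χ₀) (Additive.ofMul ρ) = -1 := by rw [AddChar.add_apply, he, hχ₀, one_mul]
      have h1 := hg (ψ + χ₀) hodd
      rw [AddChar.add_apply, hg χ₀ hχ₀, mul_one] at h1
      exact h1
    · exact hg ψ ho
  have h0 : (Additive.ofMul g : Additive G) = 0 := (AddChar.forall_apply_eq_zero (α := Additive G)).1 hall
  simpa using congrArg Additive.toMul h0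

/-- **NONDEGENERATE ⟹ TRIVIAL STABILISER** ("a nondegenerate CM-type is primitive"): if `rank(T) = |G|/2 + 1` (no
odd character vanishes on `T`, Kubota) and `tg ∈ T ⟺ t ∈ T` for all `t`, then `g = 1`.  On the field side: the
reflex field of a nondegenerate type of an abelian CM field `K` is `K` itself. [cite: Kubota1965, §2] [cite: Kubota1965, §4 Lemma 2] -/
theorem eq_one_of_forall_mul_mem_iff_of_typeRank_eq (h : IsCMTypeWith ρ (T : Set G))
    (hr : typeRank G (T : Set G) = Fintype.card G / 2 + 1) {g : G} (hg : ∀ t : G, t * g ∈ T ↔ t ∈ T) :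
    g = 1 :=
  eq_one_of_forall_odd_apply_eq_one h fun χ hχ =>
    survivor_apply_eq_one_of_forall_mul_mem_iff hg hχ (h.typeRank_eq_iff_forall_oddCharacters.1 hr χ hχ)

/-- **A TYPE WITH A NON-TRIVIAL STABILISER IS DEGENERATE**: if some `g ≠ 1` stabilises `T` then
`rank(T) ≠ |G|/2 + 1` (an imprimitive type is degenerate — the contrapositive of Kubota's remark).
[cite: Kubota1965, §2] [cite: Kubota1965, §4 Lemma 2] -/
theorem typeRank_ne_of_forall_mul_mem_iff (h : IsCMTypeWith ρ (T : Set G)) {g : G} (hg1 : g ≠ 1)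
    (hg : ∀ t : G, t * g ∈ T ↔ t ∈ T) : typeRank G (T : Set G) ≠ Fintype.card G / 2 + 1 :=
  fun hr => hg1 (eq_one_of_forall_mul_mem_iff_of_typeRank_eq h hr hg)

/-- **A non-trivial stabilising element exhibits a vanishing odd character**: `g ≠ 1`, `Tg = T` ⟹ there is an odd
`χ` with `χ(g) ≠ 1`, and every such `χ` vanishes on `T` (`Ŝ(χ) = 0`). [cite: Kubota1965, §4 Lemma 2] -/
theorem exists_odd_vanishing_of_forall_mul_mem_iff (h : IsCMTypeWith ρ (T : Set G)) {g : G} (hg1 : g ≠ 1)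
    (hg : ∀ t : G, t * g ∈ T ↔ t ∈ T) :
    ∃ χ : AddChar (Additive G) ℂ, χ (Additive.ofMul ρ) = -1 ∧ χ (Additive.ofMul g) ≠ 1 ∧
      ∑ s ∈ T, χ (Additive.ofMul s) = 0 := by
  by_contra hno
  refine hg1 (eq_one_of_forall_odd_apply_eq_one h fun χ hχ => ?_)
  by_contra hne
  by_cases hS : ∑ s ∈ T, χ (Additive.ofMul s) = 0
  · exact hno ⟨χ, hχ, hne, hS⟩
  · exact hne (survivor_apply_eq_one_of_forall_mul_mem_iff hg hχ hS)

/-- **Rank bound from a stabilising element** (degenerate by at least one: `rank(T) < |G|/2 + 1` when `g ≠ 1`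
stabilises `T`), from Kubota's `rank(T) + #{vanishing odd χ} = |G|/2 + 1`. [cite: Kubota1965, §4 Lemma 2] -/
theorem typeRank_lt_of_forall_mul_mem_iff (h : IsCMTypeWith ρ (T : Set G)) {g : G} (hg1 : g ≠ 1)
    (hg : ∀ t : G, t * g ∈ T ↔ t ∈ T) : typeRank G (T : Set G) < Fintype.card G / 2 + 1 := by
  exact lt_of_le_of_ne h.typeRank_le (typeRank_ne_of_forall_mul_mem_iff h hg1 hg)

omit [Fintype G] [DecidableEq G] in
/-- In exponent `2` characters are `±1`-valued, so `χ(g) ≠ 1 ⟺ χ(g) = −1`. [cite: Kubota1965, §4 Lemma 2 (proof)] -/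
private theorem char_ne_one_iff (hexp : ∀ g : G, g ^ 2 = 1) (χ : AddChar (Additive G) ℂ) (g : G) :
    χ (Additive.ofMul g) ≠ 1 ↔ χ (Additive.ofMul g) = -1 := by
  have hg : g * g = 1 := by rw [← pow_two]; exact hexp g
  rcases character_apply_eq_one_or_of_mul_self χ hg with h1 | h1
  · rw [h1]; norm_num
  · rw [h1]; norm_num

/-- **Exponent `2`** (multiquadratic CM fields): `g` stabilises `T` iff NO surviving odd character takes the value
`−1` at `g`; the tree's order-`16` `ExponentTwo.mul_mem_iff_of_forall_survivor_eq_one` is the direction `⟸`.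
[cite: Kubota1965, §4 Lemma 2] [cite: Dodson1984, §3.1.1 Theorem] -/
theorem forall_mul_mem_iff_iff_of_sq_eq_one (hexp : ∀ g : G, g ^ 2 = 1) (h : IsCMTypeWith ρ (T : Set G))
    (g : G) :
    (∀ t : G, t * g ∈ T ↔ t ∈ T) ↔
      ¬ ∃ χ : AddChar (Additive G) ℂ, χ (Additive.ofMul ρ) = -1 ∧ ∑ s ∈ T, χ (Additive.ofMul s) ≠ 0 ∧
        χ (Additive.ofMul g) = -1 := by
  rw [forall_mul_mem_iff_iff_forall_survivor h g]
  constructor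
  · rintro hall ⟨χ, hχ, hS, hm⟩
    have := hall χ hχ hS
    rw [hm] at this
    norm_num at this
  · intro hno χ hχ hS
    by_contra hne
    exact hno ⟨χ, hχ, hS, (char_ne_one_iff hexp χ g).1 hne⟩

end Consequences

end AbelianStabilizer

end CyclicCMType

end Literature.NumberTheory.ComplexMultiplication
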